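import Literature.Combinatorics.Optimization.ShellLawSmoothing
import Literature.Combinatorics.Optimization.ShellLawWeightedLevelStep
import HarnessLib

/-!
# Pinning one half-matched vertex: the crossing-weighted block statistic is a shifted, deleted shell average

Fix a perfect matching (`π` its partner involution, fixed-point-free), a `π`-stable ground set `S`, a block
`H`. Companion of `ShellLawPinning.lean` (two FULL edges pinned) and `ShellLawEdgeProduct.lean` §7 (one /
two full edges pinned): here ONE HALF-MATCHED VERTEX is pinned. Conditioned on `v ∈ half(U)` (i.e. `v ∈ U`,
`πv ∉ U`), the rest `U ∖ {v}` of a uniform cut of `Shell_S(t+1, c+1)` is a uniform cut of the shell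
`Shell_{S∖e_v}(t, c)` of the ground set with the edge `e_v = {v, πv}` deleted — one vertex fewer, one
crossing fewer — and `|U ∩ H|` is shifted by `[v ∈ H]`:

* §1 **`sum_shellIn_half_blockStat_eq`** — `Σ_{U ∈ Shell_S(t+1,c+1), v ∈ half U} ψ(|U∩H|) =
  Σ_{W ∈ Shell_{S∖e_v}(t,c)} ψ(|W∩H| + [v ∈ H])` (by `ShellLawWeightedLevelStep.sum_shellIn_half_eq`, lit g32 — the
  sum form of `ShellLawLevelStep`'s count `card_shellIn_half`).
* §2 **`card_shellIn_sdiff_pair_half_ratio`** — `|S|·|Shell_{S∖e}(t,c)| = (c+1)·|Shell_S(t+1,c+1)|` (double count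
  of the pairs (cut, half-matched vertex); all one-edge-deleted shells have the same size; the `ω ≡ 1` case of
  `ShellLawWeightedLevelStep.wPin_half`, kept in this unweighted cardinality form for the consumers below): the
  probability that a given vertex is half-matched is `(c+1)/|S|`, LINEAR IN THE LEVEL, VANISHING AT THE VIRTUAL LEVEL.
* §3 **`sum_shellIn_halfCount_mul_eq`** — `Σ_{U ∈ Shell_S(t+1,c+1)} |half U ∩ H|·ψ(|U∩H|) =
  Σ_{v ∈ S ∩ H} Σ_{W ∈ Shell_{S∖e_v}(t,c)} ψ(|W∩H| + 1)`, and the average form **`shellInAvg_halfCount_mul_eq`**: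
  `E_{Shell_S(t+1,c+1)}[|half U ∩ H|·ψ(|U∩H|)] = ((c+1)/|S|)·Σ_{v ∈ S∩H} E_{Shell_{S∖e_v}(t,c)}[ψ(|W∩H|+1)]` — the
  block statistic weighted by the NUMBER OF CROSSING `H`-VERTICES is `(c+1)/|S|` times a sum of plain
  block-statistic shell averages on deleted ground sets, at the cut size and level both lowered by one.
* §4 **`card_vAA_sub_card_vDD`** — for a `π`-stable vertex set `F`, `|AA(F)| − |DD(F)| = 2|F ∩ H| − |F|`; with
  `F = full(U)` (`full_stable`) and `|full U ∩ H| + |half U ∩ H| = |U ∩ H|` (`card_full_inter_add_card_half_inter`)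
  this is the identity behind the cell's "crossing direction": the containment statistic
  `Σ_p u_p x_p x_{πp}` with `u = 𝟙_{HH} − 𝟙_{H̄H̄}` equals `2(|U∩H| − |half U ∩ H|) − |full U|` on every cut —
  a BLOCK STATISTIC minus the half-count correction minus `(t − c)` (`crossing_containment_eq`).
* §5 ground-set versions of `ShellLawSmoothing` §5: **`shellInAvg_eq_sum_mul_shellLaw`**
  (`E_{Shell_S(t,c)}[ψ(|U∩H|)] = Σ_{x=0}^{t} ψ(x)·law_S(t,c;x)`), `fwdDiff_iter_shellInAvg_eq`,
  **`abs_fwdDiff_iter_shellInAvg_le`** (`|Δ^k_{(2)} E_{Shell_S(t,·)}[ψ]| ≤ G·Σ_x |Δ^k_{(2)} law_S(t,·;x)|`).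

USE (cell pnp-psdrank, prover g22, MEMO-25): with an exact extrapolation design the level profile
`c ↦ (c/|S|)·φ′(c−1)` of a half-pinned statistic has a level factor vanishing at the virtual level `c = 0`, so
its design value is a pure interpolation remainder (brick 119 `…HalfPinnedNull`): "the virtual level is
crossing-free" for smooth, non-junta profiles. All PROVED, 0 sorry, no named facts; bookkeeping on Rothvoß's
slack-matrix combinatorics.

## References
* [Rothvoss2017] T. Rothvoß, *The matching polytope has exponential extension complexity*, J. ACM 64 (2017),
  §2 (PDF pp. 5–6): cuts, the crossing number `|δ(U) ∩ M|`, the level classes.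
* [GodsilMeagher2015] C. Godsil, K. Meagher, *Erdős–Ko–Rado Theorems: Algebraic Approaches*, CUP 2015, §15.2.
-/

noncomputable section

open Finset

namespace Literature.Combinatorics.Optimization

namespace ShellStep

variable {n : ℕ} {π : Fin n → Fin n}

section HalfPin

variable (hπ : ∀ v, π (π v) = v) (hπ' : ∀ v, π v ≠ v)
include hπ hπ'

/-! ### §1 One half-matched vertex pinned: the block statistic -/

omit hπ hπ' in
/-- The block count after pinning: `|(W + v) ∩ H| = |W ∩ H| + [v ∈ H]` for `v ∉ W` (integer form).
[cite: Rothvoss2017, §2 (PDF p. 5)] -/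
theorem card_insert_inter_cast (H : Finset (Fin n)) {W : Finset (Fin n)} {v : Fin n} (hv : v ∉ W) :
    ((insert v W ∩ H).card : ℤ) = ((W ∩ H).card : ℤ) + (if v ∈ H then 1 else 0) := by
  rw [card_insert_inter H hv]
  push_cast
  split_ifs <;> simp

/-- **Pinned block-statistic sum**: `Σ_{U ∈ Shell_S(t+1,c+1), v ∈ half U} ψ(|U∩H|) =
Σ_{W ∈ Shell_{S∖e_v}(t,c)} ψ(|W∩H| + [v ∈ H])`. [cite: Rothvoss2017, §2 (PDF p. 6)] -/
theorem sum_shellIn_half_blockStat_eq {S : Finset (Fin n)} (H : Finset (Fin n))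
    {v : Fin n} (hv : v ∈ S) (t c : ℕ) (ψ : ℤ → ℝ) :
    ∑ U ∈ (shellIn π S (t + 1) (c + 1)).filter (fun U => v ∈ U ∧ π v ∉ U), ψ ((U ∩ H).card : ℤ) =
      ∑ W ∈ shellIn π (S \ {v, π v}) t c, ψ (((W ∩ H).card : ℤ) + (if v ∈ H then 1 else 0)) := by
  rw [sum_shellIn_half_eq hπ hπ' hv t c]
  refine sum_congr rfl fun W hW => ?_
  have hvW : v ∉ W := fun h => by
    have := mem_sdiff.1 ((mem_shellIn.1 hW).1 h); simp at this
  rw [card_insert_inter_cast H hvW]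

/-! ### §2 The half-pinning ratio: the probability that a given vertex is half-matched is `(c+1)/|S|` -/

/-- **Half-vertex ratio**: `|S|·|Shell_{S∖e_v}(t,c)| = (c+1)·|Shell_S(t+1,c+1)|` (double count of the pairs
(cut, half-matched vertex); all one-edge-deleted shells have the same size, `card_shellIn_eq_of_card_eq`).
[cite: Rothvoss2017, §2 (PDF p. 6)] -/
theorem card_shellIn_sdiff_pair_half_ratio {S : Finset (Fin n)} (hS : ∀ u ∈ S, π u ∈ S) {v : Fin n}
    (hv : v ∈ S) (t c : ℕ) :
    (S.card : ℝ) * (shellIn π (S \ {v, π v}) t c).card =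
      ((c : ℝ) + 1) * (shellIn π S (t + 1) (c + 1)).card := by
  -- Σ_{u ∈ S} #{U : u ∈ U, πu ∉ U} = Σ_U |half U| = (c+1)|Shell|
  have hcount : ∀ u ∈ S, (((shellIn π S (t + 1) (c + 1)).filter fun U => u ∈ U ∧ π u ∉ U).card : ℝ) =
      (shellIn π (S \ {v, π v}) t c).card := by
    intro u hu
    rw [card_shellIn_half hπ hπ' hu t c]
    have e := card_shellIn_eq_of_card_eq hπ hπ' ((S \ {u, π u}).card) (S₁ := S \ {u, π u})
      (S₂ := S \ {v, π v}) rfl (by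
        have h1 := card_sdiff_pair hπ' hS hu
        have h2 := card_sdiff_pair hπ' hS hv
        omega) (sdiff_pair_stable hπ hS u) (sdiff_pair_stable hπ hS v) t c
    exact_mod_cast e
  have hlhs : (S.card : ℝ) * (shellIn π (S \ {v, π v}) t c).card =
      ∑ u ∈ S, (((shellIn π S (t + 1) (c + 1)).filter fun U => u ∈ U ∧ π u ∉ U).card : ℝ) := by
    rw [sum_congr rfl hcount, sum_const, nsmul_eq_mul]
  rw [hlhs]
  -- swap the double count
  have hswap : ∑ u ∈ S, (((shellIn π S (t + 1) (c + 1)).filter fun U => u ∈ U ∧ π u ∉ U).card : ℝ) =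
      ∑ U ∈ shellIn π S (t + 1) (c + 1), ((half π U).card : ℝ) := by
    have eL : ∀ u ∈ S, (((shellIn π S (t + 1) (c + 1)).filter fun U => u ∈ U ∧ π u ∉ U).card : ℝ) =
        ∑ U ∈ shellIn π S (t + 1) (c + 1), if (u ∈ U ∧ π u ∉ U) then (1 : ℝ) else 0 := by
      intro u _
      rw [card_filter]; push_cast
      exact sum_congr rfl fun U _ => by split_ifs <;> simp
    have eR : ∀ U ∈ shellIn π S (t + 1) (c + 1), ((half π U).card : ℝ) =
        ∑ u ∈ S, if (u ∈ U ∧ π u ∉ U) then (1 : ℝ) else 0 := by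
      intro U hU
      have hUS : U ⊆ S := (mem_shellIn.1 hU).1
      rw [half, card_filter]; push_cast
      rw [← sum_subset hUS (fun u _ huU => by rw [if_neg (fun h => huU h.1)])]
      refine sum_congr rfl fun u hu => ?_
      by_cases h : π u ∉ U
      · rw [if_pos h, if_pos ⟨hu, h⟩]
      · rw [if_neg h, if_neg (fun h' => h h'.2)]
    rw [sum_congr rfl eL, sum_congr rfl eR, sum_comm]
  rw [hswap, sum_congr rfl fun U hU => by rw [(mem_shellIn.1 hU).2.2], sum_const, nsmul_eq_mul]
  push_cast; ring

/-- For `S ≠ ∅` the deleted shell `Shell_{S∖e_v}(t,c)` is nonempty as soon as `Shell_S(t+1,c+1)` is.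
[cite: Rothvoss2017, §2 (PDF p. 6)] -/
theorem shellIn_sdiff_pair_nonempty_of_half {S : Finset (Fin n)} (hS : ∀ u ∈ S, π u ∈ S) {v : Fin n}
    (hv : v ∈ S) {t c : ℕ} (hne : (shellIn π S (t + 1) (c + 1)).Nonempty) :
    (shellIn π (S \ {v, π v}) t c).Nonempty := by
  have h := card_shellIn_sdiff_pair_half_ratio hπ hπ' hS hv t c
  have hpos : (0 : ℝ) < ((c : ℝ) + 1) * (shellIn π S (t + 1) (c + 1)).card :=
    mul_pos (by positivity) (by exact_mod_cast hne.card_pos)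
  rw [← h] at hpos
  by_contra hemp
  rw [not_nonempty_iff_eq_empty] at hemp
  rw [hemp, card_empty, Nat.cast_zero, mul_zero] at hpos
  exact lt_irrefl _ hpos


/-! ### §3 The block statistic weighted by the number of crossing `H`-vertices -/

omit hπ hπ' in
/-- `half(U) ∩ H` as a filter of `S ∩ H` (for `U ⊆ S`). [cite: Rothvoss2017, §2 (PDF p. 5)] -/
theorem half_inter_eq_filter {S H U : Finset (Fin n)} (hUS : U ⊆ S) :
    half π U ∩ H = (S ∩ H).filter (fun v => v ∈ U ∧ π v ∉ U) := by
  ext v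
  simp only [mem_inter, mem_half, mem_filter]
  constructor
  · rintro ⟨⟨hvU, hπv⟩, hvH⟩
    exact ⟨⟨hUS hvU, hvH⟩, hvU, hπv⟩
  · rintro ⟨⟨_, hvH⟩, hvU, hπv⟩
    exact ⟨⟨hvU, hπv⟩, hvH⟩

/-- **Half-count-weighted sums split over the pinned vertex**:
`Σ_{U ∈ Shell_S(t+1,c+1)} |half U ∩ H|·g(U) = Σ_{v ∈ S ∩ H} Σ_{W ∈ Shell_{S∖e_v}(t,c)} g(W + v)`.
[cite: Rothvoss2017, §2 (PDF p. 6)] -/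
theorem sum_shellIn_halfCount_mul_eq (S H : Finset (Fin n)) (t c : ℕ) (g : Finset (Fin n) → ℝ) :
    ∑ U ∈ shellIn π S (t + 1) (c + 1), ((half π U ∩ H).card : ℝ) * g U =
      ∑ v ∈ S ∩ H, ∑ W ∈ shellIn π (S \ {v, π v}) t c, g (insert v W) := by
  calc ∑ U ∈ shellIn π S (t + 1) (c + 1), ((half π U ∩ H).card : ℝ) * g U
      = ∑ U ∈ shellIn π S (t + 1) (c + 1), ∑ v ∈ S ∩ H, (if (v ∈ U ∧ π v ∉ U) then (1 : ℝ) else 0) * g U := by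
        refine sum_congr rfl fun U hU => ?_
        rw [half_inter_eq_filter (mem_shellIn.1 hU).1, card_filter, ← sum_mul]
        push_cast
        rfl
    _ = ∑ v ∈ S ∩ H, ∑ U ∈ shellIn π S (t + 1) (c + 1), (if (v ∈ U ∧ π v ∉ U) then (1 : ℝ) else 0) * g U :=
        sum_comm
    _ = ∑ v ∈ S ∩ H, ∑ U ∈ (shellIn π S (t + 1) (c + 1)).filter (fun U => v ∈ U ∧ π v ∉ U), g U := by
        refine sum_congr rfl fun v _ => ?_
        rw [sum_filter]
        refine sum_congr rfl fun U _ => ?_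
        split_ifs <;> simp
    _ = _ := sum_congr rfl fun v hv => sum_shellIn_half_eq hπ hπ' (mem_inter.1 hv).1 t c g

/-- **The block statistic weighted by `|half U ∩ H|`** is a sum of shifted block-statistic sums on the
one-edge-deleted ground sets, at cut size and level one lower:
`Σ_{U ∈ Shell_S(t+1,c+1)} |half U ∩ H|·ψ(|U∩H|) = Σ_{v ∈ S ∩ H} Σ_{W ∈ Shell_{S∖e_v}(t,c)} ψ(|W∩H| + 1)`.
[cite: Rothvoss2017, §2 (PDF p. 6)] -/
theorem sum_shellIn_halfCount_blockStat_eq (S H : Finset (Fin n)) (t c : ℕ) (ψ : ℤ → ℝ) :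
    ∑ U ∈ shellIn π S (t + 1) (c + 1), ((half π U ∩ H).card : ℝ) * ψ ((U ∩ H).card : ℤ) =
      ∑ v ∈ S ∩ H, ∑ W ∈ shellIn π (S \ {v, π v}) t c, ψ (((W ∩ H).card : ℤ) + 1) := by
  rw [sum_shellIn_halfCount_mul_eq hπ hπ' S H t c]
  refine sum_congr rfl fun v hv => sum_congr rfl fun W hW => ?_
  have hvW : v ∉ W := fun h => by
    have := mem_sdiff.1 ((mem_shellIn.1 hW).1 h); simp at this
  rw [card_insert_inter_cast H hvW, if_pos (mem_inter.1 hv).2]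

/-- **Average form**: for `Shell_S(t+1,c+1) ≠ ∅`,
`E_{Shell_S(t+1,c+1)}[|half U ∩ H|·ψ(|U∩H|)] = ((c+1)/|S|)·Σ_{v ∈ S ∩ H} E_{Shell_{S∖e_v}(t,c)}[ψ(|W∩H| + 1)]`:
the half-count weight becomes the level factor `(c+1)/|S|`, which vanishes one level below `c + 1 = 1`.
[cite: Rothvoss2017, §2 (PDF p. 6)] [cite: GodsilMeagher2015, §15.2] -/
theorem shellInAvg_halfCount_blockStat_eq {S : Finset (Fin n)} (hS : ∀ u ∈ S, π u ∈ S) (H : Finset (Fin n))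
    (t c : ℕ) (ψ : ℤ → ℝ) (hne : (shellIn π S (t + 1) (c + 1)).Nonempty) :
    (∑ U ∈ shellIn π S (t + 1) (c + 1), ((half π U ∩ H).card : ℝ) * ψ ((U ∩ H).card : ℤ)) /
        ((shellIn π S (t + 1) (c + 1)).card : ℝ) =
      (((c : ℝ) + 1) / (S.card : ℝ)) * ∑ v ∈ S ∩ H,
        (∑ W ∈ shellIn π (S \ {v, π v}) t c, ψ (((W ∩ H).card : ℤ) + 1)) /
          ((shellIn π (S \ {v, π v}) t c).card : ℝ) := by
  rw [sum_shellIn_halfCount_blockStat_eq hπ hπ' S H t c ψ, sum_div, mul_sum]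
  refine sum_congr rfl fun v hv => ?_
  have hvS : v ∈ S := (mem_inter.1 hv).1
  have hr := card_shellIn_sdiff_pair_half_ratio hπ hπ' hS hvS t c
  have hA : (0 : ℝ) < (shellIn π S (t + 1) (c + 1)).card := by exact_mod_cast hne.card_pos
  have hB : (0 : ℝ) < (shellIn π (S \ {v, π v}) t c).card := by
    exact_mod_cast (shellIn_sdiff_pair_nonempty_of_half hπ hπ' hS hvS hne).card_pos
  have hSpos : (0 : ℝ) < S.card := by exact_mod_cast card_pos.2 ⟨v, hvS⟩
  rw [div_mul_div_comm, div_eq_div_iff hA.ne' (mul_ne_zero hSpos.ne' hB.ne')]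
  linear_combination (∑ W ∈ shellIn π (S \ {v, π v}) t c, ψ (((W ∩ H).card : ℤ) + 1)) * hr

/-! ### §4 The crossing containment statistic is a block statistic minus the half count -/

omit hπ' in
/-- `full(U)` is `π`-stable. [cite: GodsilMeagher2015, §15.2] -/
theorem full_stable (U : Finset (Fin n)) : ∀ v ∈ full π U, π v ∈ full π U := by
  intro v hv
  rw [mem_full] at hv ⊢
  exact ⟨hv.2, by rw [hπ]; exact hv.1⟩

omit hπ hπ' in
/-- `|AA(S)| + |BH(S)| = |S ∩ H|` (the `H`-vertices of `S` sorted by the type of their partner).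
[cite: Rothvoss2017, §2 (PDF p. 5)] -/
theorem card_vAA_add_card_vBH (S H : Finset (Fin n)) :
    (vAA π S H).card + (vBH π S H).card = (S ∩ H).card := by
  have h := card_filter_add_card_filter_not (s := S ∩ H) (fun v => π v ∈ H)
  have eAA : (S ∩ H).filter (fun v => π v ∈ H) = vAA π S H := by
    ext v; simp only [mem_filter, mem_inter, mem_vAA, and_assoc]
  have eBH : (S ∩ H).filter (fun v => ¬π v ∈ H) = vBH π S H := by
    ext v; simp only [mem_filter, mem_inter, mem_vBH, and_assoc]
  rw [eAA, eBH] at h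
  exact h

omit hπ' in
/-- **`|AA(S)| − |DD(S)| = 2|S ∩ H| − |S|`** for a `π`-stable `S` (since `|BH| = |BN|` and the four types
partition `S`). With `S = full(U)`: the containment statistic of the direction `𝟙_{HH} − 𝟙_{H̄H̄}`, counted on
vertices, is `2|full U ∩ H| − |full U|`. [cite: Rothvoss2017, §2 (PDF p. 5)] -/
theorem card_vAA_sub_card_vDD {S : Finset (Fin n)} (hS : ∀ v ∈ S, π v ∈ S) (H : Finset (Fin n)) :
    ((vAA π S H).card : ℤ) - (vDD π S H).card = 2 * ((S ∩ H).card : ℤ) - S.card := by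
  have h1 := card_vAA_add_card_vBH (π := π) S H
  have h2 := card_vBH_eq_card_vBN hπ hS H
  have h3 := card_types_eq (π := π) S H
  omega

omit hπ hπ' in
/-- `|full U ∩ H| + |half U ∩ H| = |U ∩ H|` (`full` and `half` partition `U`). [cite: Rothvoss2017, §2 (PDF p. 5)] -/
theorem card_full_inter_add_card_half_inter (U H : Finset (Fin n)) :
    (full π U ∩ H).card + (half π U ∩ H).card = (U ∩ H).card := by
  have h := card_filter_add_card_filter_not (s := U ∩ H) (fun v => π v ∈ U)
  have e1 : (U ∩ H).filter (fun v => π v ∈ U) = full π U ∩ H := by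
    ext v; simp only [mem_filter, mem_inter, mem_full]; tauto
  have e2 : (U ∩ H).filter (fun v => ¬π v ∈ U) = half π U ∩ H := by
    ext v; simp only [mem_filter, mem_inter, mem_half]; tauto
  rw [e1, e2] at h
  exact h

omit hπ' in
/-- **The crossing containment statistic on a shell**: for `U ∈ Shell_S(t,c)`,
`|AA(full U)| − |DD(full U)| = 2(|U ∩ H| − |half U ∩ H|) − (t − c)` — twice the number of full `HH` edges minus
twice the number of full `H̄H̄` edges is twice the block count, minus twice the number of crossing `H`-vertices,
minus the number of fully matched vertices. At the virtual level (no crossings, `t − c ↦ t`) it would be the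
deterministic function `2|U∩H| − t` of the block count. [cite: Rothvoss2017, §2 (PDF pp. 5–6)] -/
theorem crossing_containment_eq (H : Finset (Fin n)) {S : Finset (Fin n)} {t c : ℕ} {U : Finset (Fin n)}
    (hU : U ∈ shellIn π S t c) :
    ((vAA π (full π U) H).card : ℤ) - (vDD π (full π U) H).card =
      2 * (((U ∩ H).card : ℤ) - ((half π U ∩ H).card : ℤ)) - ((t : ℤ) - c) := by
  rw [card_vAA_sub_card_vDD hπ (full_stable hπ U) H]
  have h1 := card_full_inter_add_card_half_inter (π := π) U H
  have h2 := card_full_of_mem_shellIn hU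
  have h3 := le_of_mem_shellIn hU
  have h4 : ((full π U).card : ℤ) = (t : ℤ) - c := by
    rw [h2, Nat.cast_sub h3]
  rw [h4]
  have h5 : ((full π U ∩ H).card : ℤ) = ((U ∩ H).card : ℤ) - ((half π U ∩ H).card : ℤ) := by
    have : ((full π U ∩ H).card : ℤ) + ((half π U ∩ H).card : ℤ) = ((U ∩ H).card : ℤ) := by
      exact_mod_cast h1
    linarith
  rw [h5]

end HalfPin

/-! ### §5 Shell averages of a block statistic inside a ground set -/

/-- **`E_{Shell_S(t,c)}[ψ(|U ∩ H|)] = Σ_{x=0}^{t} ψ(x) · law_S(t,c;x)`** (both sides `0` for an empty shell); the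
ground-set version of `shellAvg_eq_sum_mul_shellLaw`. [cite: Rothvoss2017, §2 (PDF p. 6)] -/
theorem shellInAvg_eq_sum_mul_shellLaw (S H : Finset (Fin n)) (t c : ℕ) (ψ : ℤ → ℝ) :
    (∑ U ∈ shellIn π S t c, ψ ((U ∩ H).card : ℤ)) / ((shellIn π S t c).card : ℝ) =
      ∑ x ∈ Icc (0 : ℤ) t, ψ x * shellLaw π S H t c x := by
  have hmaps : ∀ U ∈ shellIn π S t c, ((U ∩ H).card : ℤ) ∈ Icc (0 : ℤ) t := by
    intro U hU
    rw [mem_Icc]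
    refine ⟨by positivity, ?_⟩
    have h1 : (U ∩ H).card ≤ U.card := card_le_card inter_subset_left
    have h2 : U.card = t := (mem_shellIn.1 hU).2.1
    exact_mod_cast h2 ▸ h1
  rw [← sum_fiberwise_of_maps_to hmaps, sum_div]
  refine sum_congr rfl fun x _ => ?_
  rw [shellLaw, shellCount]
  have : ∑ U ∈ (shellIn π S t c).filter (fun U => ((U ∩ H).card : ℤ) = x), ψ ((U ∩ H).card : ℤ) =
      ψ x * (((shellIn π S t c).filter fun U => ((U ∩ H).card : ℤ) = x).card : ℝ) := by
    rw [mul_comm, ← nsmul_eq_mul, ← sum_const]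
    refine sum_congr rfl fun U hU => ?_
    rw [(mem_filter.1 hU).2]
  rw [this, mul_div_assoc]

/-- **Level differences of the shell profile inside a ground set**:
`Δ^k_{(2)}[c ↦ E_{Shell_S(t,c)}[ψ(|U∩H|)]](c) = Σ_x ψ(x) · Δ^k_{(2)}[law_S(t,·;x)](c)`.
[cite: Rothvoss2017, §2 (PDF p. 6)] -/
theorem fwdDiff_iter_shellInAvg_eq (S H : Finset (Fin n)) (t k c : ℕ) (ψ : ℤ → ℝ) :
    (fwdDiff 2)^[k] (fun c => (∑ U ∈ shellIn π S t c, ψ ((U ∩ H).card : ℤ)) / ((shellIn π S t c).card : ℝ)) c =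
      ∑ x ∈ Icc (0 : ℤ) t, ψ x * (fwdDiff 2)^[k] (fun c' x => shellLaw π S H t c' x : Profile) c x := by
  have hfun : (fun c => (∑ U ∈ shellIn π S t c, ψ ((U ∩ H).card : ℤ)) / ((shellIn π S t c).card : ℝ)) =
      fun c => ∑ x ∈ Icc (0 : ℤ) t, ψ x * shellLaw π S H t c x := by
    funext c; exact shellInAvg_eq_sum_mul_shellLaw S H t c ψ
  rw [hfun, fwdDiff_iter_eq_sum_shift]
  have hP : ∀ x : ℤ, (fwdDiff 2)^[k] (fun c' x => shellLaw π S H t c' x : Profile) c x =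
      ∑ i ∈ range (k + 1), ((-1 : ℤ) ^ (k - i) * (k.choose i : ℤ)) • shellLaw π S H t (c + i • 2) x := by
    intro x
    rw [fwdDiff_iter_eq_sum_shift]
    simp only [Finset.sum_apply, Pi.smul_apply]
  simp only [hP, mul_sum, smul_eq_mul, zsmul_eq_mul]
  rw [sum_comm]
  refine sum_congr rfl fun i _ => sum_congr rfl fun x _ => ?_
  push_cast
  ring

/-- **`ℓ¹` control inside a ground set**: if `|ψ| ≤ G` on `[0,t]` then
`|Δ^k_{(2)}[c ↦ E_{Shell_S(t,c)}[ψ(|U∩H|)]](c)| ≤ G · Σ_{x=0}^{t} |Δ^k_{(2)}[law_S(t,·;x)](c)|`.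
[cite: RollinRoss2010, §3 (Lemma 3.1: duality of the `ℓ¹` smoothness functional)] -/
theorem abs_fwdDiff_iter_shellInAvg_le (S H : Finset (Fin n)) (t k c : ℕ) (ψ : ℤ → ℝ) {G : ℝ}
    (hG : ∀ x ∈ Icc (0 : ℤ) t, |ψ x| ≤ G) :
    |(fwdDiff 2)^[k] (fun c => (∑ U ∈ shellIn π S t c, ψ ((U ∩ H).card : ℤ)) / ((shellIn π S t c).card : ℝ)) c| ≤
      G * ∑ x ∈ Icc (0 : ℤ) t, |(fwdDiff 2)^[k] (fun c' x => shellLaw π S H t c' x : Profile) c x| := by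
  rw [fwdDiff_iter_shellInAvg_eq, mul_sum]
  refine (abs_sum_le_sum_abs _ _).trans (sum_le_sum fun x hx => ?_)
  rw [abs_mul]
  exact mul_le_mul_of_nonneg_right (hG x hx) (abs_nonneg _)

end ShellStep

end Literature.Combinatorics.Optimization

end
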